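import Literature.Probability.RandomPlanarGeometry.SAWTriangularBridgeRenewal
import Literature.Probability.RandomPlanarGeometry.SAWTriangularUnfolding
import Literature.Probability.RandomPlanarGeometry.SAWTriangularDetourAdapter
import Literature.Probability.RandomPlanarGeometry.SAWBridgeDivergence
import Literature.Probability.Process.RenewalTheorem
import HarnessLib

/-!
# The bridge generating function of the triangular lattice diverges at `1/μ(𝕋)`, and Kesten's relation
# `Σ_k λ_k(𝕋) μ(𝕋)^{−k} = 1`

Topic `Literature/Probability/RandomPlanarGeometry` (lane «pcv-sawmu», door «TRI-KESTEN»; continues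
`SAWTriangularBridgeRenewal.lean`: irreducible bridges `λ_n(𝕋)`, the renewal equation (M–S (4.2.2) on `𝕋`)
and Feller's `Σ λ_k μ^{−k} ≤ 1` / `= 1` given divergence; inputs `SAWTriangularBridges.lean`
(`c_n(𝕋) ≤ Σ_m h_{m+1} h_{n−m}`, cut at the last minimum), `SAWTriangularUnfolding.lean`
(`brickGraph_adj_reflCoord`), `SAWTriangularDetourAdapter.lean` (`μ(𝕋)^n ≤ c_n(𝕋)`), and the TREE's `ℤ^d`
file `SAWBridgeDivergence.lean`, whose architecture is ported verbatim to the brick frame (its own theorems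
are about nearest-neighbour walks of `ℤ^d` and do not apply to `𝕋`; reused: `Zd.lastArgmax`, `Zd.maxLevel`,
`Zd.reflCoord`, `Zd.sum_range_triangle_le`)). Sources: N. Madras, G. Slade, *The Self-Avoiding Walk* (1993),
Corollary 3.1.8 and its proof, eqs. (3.1.11)–(3.1.14), pp. 61–62 (`ℤ^d`: "every half-space walk may be
decomposed into bridges of spans `A_1 > A_2 > …`", `Σ_N h_N z^N ≤ exp(B_z − 1)`, `Σ c_N z^N ≤ z^{−1} e^{2(B_z−1)}`,
divergence at `z_c`), §4.2 eq. (4.2.4) p. 91 (Kesten's relation); H. Kesten, J. Math. Phys. 4 (1963) 960–969,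
§4; for the triangular lattice Kesten's relation is ASSERTED AND USED by I. Jensen, J. Phys. A 37 (2004)
11521, §2 and S. E. Alm, R. Parviainen, J. Phys. A 37 (2004) 549 by appeal to Kesten 1963, with no written
proof located (lit-2 gen 12) — this file is the first written proof text for `𝕋` (consolidation-grade).

What is here (all PROVED): the span recursion in the brick frame (`triSpanHead`, `triSpanTail`,
`card_triHsSpan_le` = one-step (3.1.12): cut a half-space walk of `𝕋` at the LAST maximum of its height,
head = bridge of span `A`, reflected tail = half-space walk of span `< A`), the truncated generating functions
`triHsLTGF`, `triBrGF`, `triBridgeGFpos` with `triT_le_exp`, `sum_brickHalfSpaceCount_le_exp`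
(`Σ_{n≤M} h_n(𝕋) z^n ≤ exp Σ_{1≤n≤M} b_n(𝕋) z^n`; spans of `n`-step brick walks are `≤ 2n`),
`sum_triSawCount_le_exp` ((3.1.13) on `𝕋`), `half_log_le_sum_brickBridgeCount` ((3.1.14) on `𝕋`:
`Σ_{n=1}^{M+1} b_n(𝕋) μ(𝕋)^{−n} ≥ ½ log((M+1)/μ(𝕋))`), **`not_summable_brickBridgeCount_div_pow`** (M–S
Cor. 3.1.8 on `𝕋`: `Σ_n b_n(𝕋) μ(𝕋)^{−n} = ∞`) and **`hasSum_brickIrreducibleBridgeCount_div_pow`** —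
KESTEN'S RELATION `Σ_k λ_k(𝕋) μ(𝕋)^{−k} = 1` on the triangular lattice, unconditionally
(`tsum_brickIrreducibleBridgeCount_div_pow`: `Σ' = 1`); and, by the Erdős–Feller–Pollard renewal theorem
(`Literature/Probability/Process/RenewalTheorem.lean`), **`exists_tendsto_brickBridgeCount_div_pow`** —
`lim_N b_N(𝕋) μ(𝕋)^{−N}` EXISTS (M–S p. 91, first display after (4.2.9), printed for `ℤ^d`; whether the limit
is `0` is the open sentence of M–S p. 92 and stays open here). Status in print for `𝕋` (lit-2 gen 12):
Kesten's method of irreducible bridges is used for the triangular lattice by I. Jensen, J. Phys. A 37 (2004)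
§2 ("`1/μ` is the solution to `A(x) = 1`"; `μ(𝕋) > 4.118935`) and quoted in S. E. Alm, J. Phys. A 38 (2005)
§5.5.1, by appeal to Kesten 1963 (Thm 5), proved in print for `ℤ^d` only.
-/

noncomputable section

open Finset Filter Topology Literature.Probability.LatticeModels Literature.Probability.Percolation SimpleGraph
open scoped BigOperators

namespace Literature.Probability.RandomPlanarGeometry.SAW

/-- The height of a brick walk moves by at most `2` per step: `X(ω(i)) ≤ 2i`. [cite: MadrasSlade1993, §1.1] -/
theorem apply_zero_le_two_mul_of_brick {n : ℕ} {ω : ℕ → Site 2} (h0 : ω 0 = 0)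
    (hadj : ∀ i < n, brickGraph.Adj (ω i) (ω (i + 1))) (i : ℕ) (hi : i ≤ n) :
    ω i 0 ≤ 2 * (i : ℤ) := by
  induction i with
  | zero => simp [h0]
  | succ i ih =>
    have h1 := ih (by omega)
    have h2 := hadj i (by omega)
    rw [brickGraph_adj_iff] at h2
    push_cast
    omega

/-! ### Cutting a half-space walk at the last maximum of its first coordinate -/

/-- The piece of `ω` up to the last time `m = n₁(ω)` the first coordinate is maximal, as an `m`-step
walk (frozen after `m`): a bridge of span `A₁(ω)`.
[cite: MadrasSlade1993, §3.1, proof of Proposition 3.1.5 / Corollary 3.1.8 (eq. (3.1.12))] -/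
def triSpanHead (n : ℕ) (ω : ℕ → Site 2) : ℕ → Site 2 :=
  fun i => ω (min i (Zd.lastArgmax n ω))

/-- The piece of `ω` after the last maximum `m`, translated to start at `0` and reflected in the
first coordinate: an `(n-m)`-step half-space walk of span `< A₁(ω)`.
[cite: MadrasSlade1993, §3.1, proof of Corollary 3.1.8 (eq. (3.1.12))] -/
def triSpanTail (n : ℕ) (ω : ℕ → Site 2) : ℕ → Site 2 :=
  fun i => Zd.reflCoord 0 (ω (Zd.lastArgmax n ω + min i (n - Zd.lastArgmax n ω)) - ω (Zd.lastArgmax n ω))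

/-- Values of `triSpanHead` (unfolding lemma). [cite: MadrasSlade1993, §3.1, proof of Corollary 3.1.8] -/
theorem triSpanHead_apply {n m : ℕ} {ω : ℕ → Site 2} (hm : Zd.lastArgmax n ω = m) (i : ℕ) :
    triSpanHead n ω i = ω (min i m) := by
  simp only [triSpanHead, hm]

/-- Values of `triSpanTail` (unfolding lemma). [cite: MadrasSlade1993, §3.1, proof of Corollary 3.1.8] -/
theorem triSpanTail_apply {n m : ℕ} {ω : ℕ → Site 2} (hm : Zd.lastArgmax n ω = m) (i : ℕ) :
    triSpanTail n ω i = Zd.reflCoord 0 (ω (m + min i (n - m)) - ω m) := by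
  simp only [triSpanTail, hm]

/-- First coordinate of `triSpanTail` (unfolding lemma). [cite: MadrasSlade1993, §3.1, proof of Corollary 3.1.8] -/
theorem triSpanTail_apply_zero {n m : ℕ} {ω : ℕ → Site 2} (hm : Zd.lastArgmax n ω = m) (i : ℕ) :
    triSpanTail n ω i 0 = ω m 0 - ω (m + min i (n - m)) 0 := by
  rw [triSpanTail_apply hm, Zd.reflCoord_apply_zero]
  simp

/-- `Zd.reflCoord 0 0 = 0`. [folklore] -/
private theorem triReflCoord_zero_zero : Zd.reflCoord 0 (0 : Site 2) = 0 := by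
  funext j
  by_cases hj : j = 0
  · subst hj; simp
  · simp [hj]

/-- **The head piece is a bridge of span `A₁(ω)`** (for a half-space walk `ω`: `ω₁(0) < ω₁(i)` for
`i ≥ 1`, and `ω₁(i) ≤ ω₁(m) = A₁` for `i ≤ m`). [cite: MadrasSlade1993, §3.1, proof of Proposition 3.1.5 ("each of the sub walks … is either a bridge or the reflection of one")] -/
theorem triSpanHead_mem {n : ℕ} {ω : ℕ → Site 2} (hω : ω ∈ brickHalfSpaceWalks n) :
    triSpanHead n ω ∈ brickBridges (Zd.lastArgmax n ω) ∧
      triSpanHead n ω (Zd.lastArgmax n ω) 0 = Zd.maxLevel n ω := by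
  obtain ⟨hωs, hhs⟩ := mem_brickHalfSpaceWalks.1 hω
  obtain ⟨h0, hend, hadj, hinj⟩ := mem_brickSaws.1 hωs
  obtain ⟨m, hm⟩ : ∃ m, Zd.lastArgmax n ω = m := ⟨_, rfl⟩
  obtain ⟨hmn, hmax⟩ := Zd.lastArgmax_spec n ω
  rw [hm] at hmn hmax ⊢
  refine ⟨mem_brickBridges.2 ⟨mem_brickSaws.2 ⟨?_, ?_, ?_, ?_⟩, ?_⟩, ?_⟩
  · rw [triSpanHead_apply hm, Nat.zero_min, h0]
  · intro i hi
    rw [triSpanHead_apply hm, triSpanHead_apply hm, min_eq_right hi, min_self]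
  · intro i hi
    rw [triSpanHead_apply hm, triSpanHead_apply hm, min_eq_left hi.le, min_eq_left (by omega : i + 1 ≤ m)]
    exact hadj i (by omega)
  · intro i hi j hj hij
    simp only [Set.mem_setOf_eq] at hi hj
    rw [triSpanHead_apply hm, triSpanHead_apply hm, min_eq_left hi, min_eq_left hj] at hij
    exact hinj (by simp only [Set.mem_setOf_eq]; omega)
      (by simp only [Set.mem_setOf_eq]; omega) hij
  · intro i h1 h2
    rw [triSpanHead_apply hm, triSpanHead_apply hm, triSpanHead_apply hm, Nat.zero_min,
      min_eq_left h2, min_self, hmax]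
    exact ⟨hhs i h1 (by omega), Zd.apply_le_maxLevel ω (by omega)⟩
  · rw [triSpanHead_apply hm, min_self, hmax]

/-- **The tail piece is a half-space walk** (after `n₁` the first coordinate is strictly below the
maximum, so after reflection it is strictly above the new starting level).
[cite: MadrasSlade1993, §3.1, proof of Corollary 3.1.8] -/
theorem triSpanTail_mem {n : ℕ} {ω : ℕ → Site 2} (hω : ω ∈ brickHalfSpaceWalks n) :
    triSpanTail n ω ∈ brickHalfSpaceWalks (n - Zd.lastArgmax n ω) := by
  obtain ⟨hωs, -⟩ := mem_brickHalfSpaceWalks.1 hω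
  obtain ⟨h0, hend, hadj, hinj⟩ := mem_brickSaws.1 hωs
  obtain ⟨m, hm⟩ : ∃ m, Zd.lastArgmax n ω = m := ⟨_, rfl⟩
  obtain ⟨hmn, hmax⟩ := Zd.lastArgmax_spec n ω
  rw [hm] at hmn hmax ⊢
  have hlt : ∀ i, m < i → i ≤ n → ω i 0 < ω m 0 := fun i h1 h2 => by
    rw [hmax]; exact Zd.apply_lt_maxLevel_of_lastArgmax_lt ω (hm ▸ h1) h2
  refine mem_brickHalfSpaceWalks.2 ⟨mem_brickSaws.2 ⟨?_, ?_, ?_, ?_⟩, ?_⟩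
  · rw [triSpanTail_apply hm, Nat.zero_min, add_zero, sub_self, triReflCoord_zero_zero]
  · intro i hi
    rw [triSpanTail_apply hm, triSpanTail_apply hm, min_eq_right hi, min_self]
  · intro i hi
    rw [triSpanTail_apply hm, triSpanTail_apply hm, min_eq_left hi.le,
      min_eq_left (by omega : i + 1 ≤ n - m)]
    refine brickGraph_adj_reflCoord 0 ?_
    rw [brickGraph_adj_sub_right, ← add_assoc]
    exact hadj (m + i) (by omega)
  · intro i hi j hj hij
    simp only [Set.mem_setOf_eq] at hi hj
    rw [triSpanTail_apply hm, triSpanTail_apply hm, min_eq_left hi, min_eq_left hj] at hij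
    have h1 := Zd.reflCoord_injective 0 hij
    rw [sub_left_inj] at h1
    have := hinj (by simp only [Set.mem_setOf_eq]; omega : m + i ∈ {i | i ≤ n})
      (by simp only [Set.mem_setOf_eq]; omega : m + j ∈ {i | i ≤ n}) h1
    omega
  · intro i h1 h2
    rw [triSpanTail_apply_zero hm, triSpanTail_apply_zero hm, Nat.zero_min, add_zero, sub_self,
      min_eq_left h2, sub_pos]
    exact hlt (m + i) (by omega) (by omega)

/-- **The tail piece has span `< A₁(ω)`** as soon as `A₁(ω) ≥ 1`: its first coordinate at time
`i ≥ 1` is `A₁ - ω₁(m+i) ≤ A₁ - 1` (the walk stays strictly above level `0`), and `0` at time `0`.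
[cite: MadrasSlade1993, §3.1, proof of Corollary 3.1.8 ("A₁ > A₂ > …")] -/
theorem maxLevel_triSpanTail_lt {n : ℕ} {ω : ℕ → Site 2} (hω : ω ∈ brickHalfSpaceWalks n)
    (hA : 1 ≤ Zd.maxLevel n ω) :
    Zd.maxLevel (n - Zd.lastArgmax n ω) (triSpanTail n ω) < Zd.maxLevel n ω := by
  obtain ⟨hωs, hhs⟩ := mem_brickHalfSpaceWalks.1 hω
  obtain ⟨h0, -, -, -⟩ := mem_brickSaws.1 hωs
  obtain ⟨m, hm⟩ : ∃ m, Zd.lastArgmax n ω = m := ⟨_, rfl⟩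
  obtain ⟨hmn, hmax⟩ := Zd.lastArgmax_spec n ω
  rw [hm] at hmn hmax ⊢
  have h00 : ω 0 0 = 0 := by rw [h0]; rfl
  refine Int.lt_of_le_sub_one (Zd.maxLevel_le fun i hi => ?_)
  rw [triSpanTail_apply_zero hm, min_eq_left hi, hmax]
  rcases Nat.eq_zero_or_pos i with rfl | hipos
  · rw [add_zero, ← hmax]; linarith
  · have := hhs (m + i) (by omega) (by omega)
    rw [h00] at this
    linarith

/-- **The walk is recovered from `n₁`, the head piece and the tail piece.**
[cite: MadrasSlade1993, §3.1, proof of Corollary 3.1.8 ("the sequence of bridges uniquely determines the original half-space walk")] -/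
theorem tri_eq_of_pieces_eq {n : ℕ} {ω ω' : ℕ → Site 2} (hω : ω ∈ brickSaws n) (hω' : ω' ∈ brickSaws n)
    (hmm : Zd.lastArgmax n ω = Zd.lastArgmax n ω') (hh : triSpanHead n ω = triSpanHead n ω')
    (ht : triSpanTail n ω = triSpanTail n ω') : ω = ω' := by
  obtain ⟨h0, hend, -, -⟩ := mem_brickSaws.1 hω
  obtain ⟨h0', hend', -, -⟩ := mem_brickSaws.1 hω'
  obtain ⟨m, hm⟩ : ∃ m, Zd.lastArgmax n ω = m := ⟨_, rfl⟩
  have hm' : Zd.lastArgmax n ω' = m := hmm.symm.trans hm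
  have hmn : m ≤ n := hm ▸ (Zd.lastArgmax_spec n ω).1
  have hωm : ω m = ω' m := by
    have := congrFun hh m
    rwa [triSpanHead_apply hm, triSpanHead_apply hm', min_self] at this
  funext i
  rcases le_or_gt i m with hi | hi
  · have := congrFun hh i
    rwa [triSpanHead_apply hm, triSpanHead_apply hm', min_eq_left hi] at this
  · rcases le_or_gt i n with hin | hin
    · have := congrFun ht (i - m)
      rw [triSpanTail_apply hm, triSpanTail_apply hm', min_eq_left (by omega : i - m ≤ n - m),
        show m + (i - m) = i by omega] at this
      have h1 := Zd.reflCoord_injective 0 this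
      rwa [hωm, sub_left_inj] at h1
    · have := congrFun ht (n - m)
      rw [triSpanTail_apply hm, triSpanTail_apply hm', min_self, show m + (n - m) = n by omega] at this
      have h1 := Zd.reflCoord_injective 0 this
      rw [hωm, sub_left_inj] at h1
      rw [hend i hin.le, hend' i hin.le, h1]

/-! ### The one-step form of (3.1.12) -/

open Classical in
/-- Half-space walks of length `n` and span `A` (`h_{n,A}` counts them). [cite: MadrasSlade1993, Definition 3.1.3] -/
def triHsSpan (n : ℕ) (A : ℤ) : Finset (ℕ → Site 2) :=
  (brickHalfSpaceWalks n).filter fun ω => Zd.maxLevel n ω = A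

open Classical in
/-- Half-space walks of length `n` and span `< A`. [cite: MadrasSlade1993, Definition 3.1.3] -/
def triHsSpanLT (n : ℕ) (A : ℤ) : Finset (ℕ → Site 2) :=
  (brickHalfSpaceWalks n).filter fun ω => Zd.maxLevel n ω < A

open Classical in
/-- Bridges of length `n` and span `A` (`b_{n,A}` counts them; the span of a bridge from `0` is the
first coordinate of its endpoint). [cite: MadrasSlade1993, Definition 3.1.3] -/
def triBrSpan (n : ℕ) (A : ℤ) : Finset (ℕ → Site 2) :=
  (brickBridges n).filter fun ω => ω n 0 = A

/-- **`h_{n,A} ≤ Σ_{m=0}^{n} b_{m,A} · h^{<A}_{n-m}`** for `A ≥ 1`: the one-step form of Madras–Slade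
(3.1.12) (cut at the last maximum; head = bridge of span `A`, reflected tail = half-space walk of
span `< A`; injective). [cite: MadrasSlade1993, §3.1, proof of Corollary 3.1.8, eq. (3.1.12)] -/
theorem card_triHsSpan_le (n : ℕ) {A : ℤ} (hA : 1 ≤ A) :
    (triHsSpan n A).card ≤
      ∑ m ∈ Finset.range (n + 1), (triBrSpan m A).card * (triHsSpanLT (n - m) A).card := by
  classical
  have hcard : ((Finset.range (n + 1)).sigma fun m => triBrSpan m A ×ˢ triHsSpanLT (n - m) A).card =
      ∑ m ∈ Finset.range (n + 1), (triBrSpan m A).card * (triHsSpanLT (n - m) A).card := by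
    rw [Finset.card_sigma]; simp_rw [Finset.card_product]
  rw [← hcard]
  refine Finset.card_le_card_of_injOn
    (fun ω => (⟨Zd.lastArgmax n ω, (triSpanHead n ω, triSpanTail n ω)⟩ :
      Σ _ : ℕ, (ℕ → Site 2) × (ℕ → Site 2))) ?_ ?_
  · intro ω hω
    rw [Finset.mem_coe, triHsSpan, Finset.mem_filter] at hω
    obtain ⟨hω, hspan⟩ := hω
    rw [Finset.mem_coe, Finset.mem_sigma, Finset.mem_range, Finset.mem_product, triBrSpan,
      Finset.mem_filter, triHsSpanLT, Finset.mem_filter]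
    obtain ⟨hhead, hheadA⟩ := triSpanHead_mem hω
    dsimp only
    refine ⟨Nat.lt_succ_of_le (Zd.lastArgmax_spec n ω).1, ⟨hhead, ?_⟩, triSpanTail_mem hω, ?_⟩
    · rw [hheadA, hspan]
    · rw [← hspan]
      exact maxLevel_triSpanTail_lt hω (hspan ▸ hA)
  · intro ω hω ω' hω' h
    rw [Finset.mem_coe, triHsSpan, Finset.mem_filter] at hω hω'
    simp only [Sigma.mk.inj_iff] at h
    obtain ⟨hmm, h⟩ := h
    have h' : (triSpanHead n ω, triSpanTail n ω) = (triSpanHead n ω', triSpanTail n ω') := eq_of_heq h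
    simp only [Prod.mk.injEq] at h'
    exact tri_eq_of_pieces_eq (mem_brickHalfSpaceWalks.1 hω.1).1 (mem_brickHalfSpaceWalks.1 hω'.1).1 hmm h'.1 h'.2

/-! ### Generating functions, truncated at length `M` -/




/-- `T_M(A) = Σ_{n≤M} h^{<A}_n zⁿ` (half-space walks of span `< A`, truncated at length `M`).
[cite: MadrasSlade1993, §3.1, proof of Corollary 3.1.8] -/
def triHsLTGF (M : ℕ) (z : ℝ) (A : ℤ) : ℝ :=
  ∑ n ∈ Finset.range (M + 1), ((triHsSpanLT n A).card : ℝ) * z ^ n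

/-- `V_M(A) = Σ_{n≤M} b_{n,A} zⁿ` (bridges of span `A`, truncated at length `M`).
[cite: MadrasSlade1993, §3.1, proof of Corollary 3.1.8] -/
def triBrGF (M : ℕ) (z : ℝ) (A : ℤ) : ℝ :=
  ∑ n ∈ Finset.range (M + 1), ((triBrSpan n A).card : ℝ) * z ^ n

/-- `B⁺_M(z) = Σ_{1≤n≤M} b_n zⁿ`, the truncation of `B_z - 1`. [cite: MadrasSlade1993, Definition 3.1.7] -/
def triBridgeGFpos (M : ℕ) (z : ℝ) : ℝ :=
  ∑ n ∈ Finset.range (M + 1), if n = 0 then 0 else (brickBridgeCount n : ℝ) * z ^ n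


/-- `T_M(A+1) = T_M(A) + Σ_{n≤M} h_{n,A} zⁿ` (splitting by the exact span; a step of the product bound). [cite: MadrasSlade1993, §3.1, proof of Corollary 3.1.8] -/
theorem triHsLTGF_succ (M : ℕ) (z : ℝ) (A : ℤ) :
    triHsLTGF M z (A + 1) =
      triHsLTGF M z A + ∑ n ∈ Finset.range (M + 1), ((triHsSpan n A).card : ℝ) * z ^ n := by
  classical
  rw [triHsLTGF, triHsLTGF, ← Finset.sum_add_distrib]
  refine Finset.sum_congr rfl fun n _ => ?_
  rw [← add_mul]
  congr 1
  have : triHsSpanLT n (A + 1) = triHsSpanLT n A ∪ triHsSpan n A := by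
    ext ω
    simp only [triHsSpanLT, triHsSpan, Finset.mem_union, Finset.mem_filter]
    constructor
    · rintro ⟨h, hlt⟩
      rcases lt_or_eq_of_le (Int.lt_add_one_iff.1 hlt) with h1 | h1
      · exact Or.inl ⟨h, h1⟩
      · exact Or.inr ⟨h, h1⟩
    · rintro (⟨h, h1⟩ | ⟨h, h1⟩)
      · exact ⟨h, by omega⟩
      · exact ⟨h, by omega⟩
  rw [this, Finset.card_union_of_disjoint, Nat.cast_add]
  exact Finset.disjoint_filter.2 fun ω _ h1 h2 => by omega

/-- The recursion **`Σ_{n≤M} h_{n,A} zⁿ ≤ V_M(A) · T_M(A)`** for `A ≥ 1`, `z ≥ 0`.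
[cite: MadrasSlade1993, §3.1, proof of Corollary 3.1.8 (eq. (3.1.12))] -/
theorem sum_triHsSpan_le (M : ℕ) {z : ℝ} (hz : 0 ≤ z) {A : ℤ} (hA : 1 ≤ A) :
    ∑ n ∈ Finset.range (M + 1), ((triHsSpan n A).card : ℝ) * z ^ n ≤
      triBrGF M z A * triHsLTGF M z A := by
  calc ∑ n ∈ Finset.range (M + 1), ((triHsSpan n A).card : ℝ) * z ^ n
      ≤ ∑ n ∈ Finset.range (M + 1), ∑ m ∈ Finset.range (n + 1),
          (((triBrSpan m A).card : ℝ) * z ^ m) * (((triHsSpanLT (n - m) A).card : ℝ) * z ^ (n - m)) := by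
        refine Finset.sum_le_sum fun n hn => ?_
        rw [Finset.mem_range] at hn
        have h1 : ((triHsSpan n A).card : ℝ) ≤
            ∑ m ∈ Finset.range (n + 1), ((triBrSpan m A).card : ℝ) * (triHsSpanLT (n - m) A).card := by
          exact_mod_cast card_triHsSpan_le n hA
        calc ((triHsSpan n A).card : ℝ) * z ^ n
            ≤ (∑ m ∈ Finset.range (n + 1),
                ((triBrSpan m A).card : ℝ) * (triHsSpanLT (n - m) A).card) * z ^ n :=
              mul_le_mul_of_nonneg_right h1 (pow_nonneg hz n)
          _ = _ := by
              rw [Finset.sum_mul]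
              refine Finset.sum_congr rfl fun m hm => ?_
              rw [Finset.mem_range] at hm
              rw [show z ^ n = z ^ m * z ^ (n - m) by rw [← pow_add]; congr 1; omega]
              ring
    _ ≤ triBrGF M z A * triHsLTGF M z A :=
        Zd.sum_range_triangle_le (f := fun m => ((triBrSpan m A).card : ℝ) * z ^ m)
          (g := fun k => ((triHsSpanLT k A).card : ℝ) * z ^ k)
          (fun i => by positivity) (fun i => by positivity) M

/-- `T_M(1) ≤ 1`: a half-space walk of span `< 1` has span `0`, hence length `0` (for `n ≥ 1`,
`ω₁(1) ≥ 1`), and there is exactly one `0`-step walk (base of the induction on the span).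
[cite: MadrasSlade1993, §3.1, proof of Corollary 3.1.8] -/
theorem triHsLTGF_one_le (M : ℕ) (z : ℝ) : triHsLTGF M z 1 ≤ 1 := by
  classical
  rw [triHsLTGF, Finset.sum_range_succ', pow_zero, mul_one]
  have h0 : ∀ n, ((triHsSpanLT (n + 1) 1).card : ℝ) * z ^ (n + 1) = 0 := by
    intro n
    rw [mul_eq_zero]; left
    rw [Nat.cast_eq_zero, Finset.card_eq_zero, triHsSpanLT, Finset.filter_eq_empty_iff]
    intro ω hω hlt
    obtain ⟨hωs, hhs⟩ := mem_brickHalfSpaceWalks.1 hω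
    obtain ⟨h00, -, -, -⟩ := mem_brickSaws.1 hωs
    have h1 := hhs 1 le_rfl (by omega)
    have h2 := Zd.apply_le_maxLevel ω (show 1 ≤ n + 1 by omega)
    have h3 : ω 0 0 = 0 := by rw [h00]; rfl
    omega
  simp only [h0, Finset.sum_const_zero, zero_add]
  have : (triHsSpanLT 0 1).card ≤ 1 := by
    calc (triHsSpanLT 0 1).card ≤ (brickSaws 0).card :=
          Finset.card_le_card fun ω hω => (mem_brickHalfSpaceWalks.1 (Finset.mem_filter.1 hω).1).1
      _ = 1 := by rw [card_brickSaws, triSawCount_zero]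
  exact_mod_cast this

/-- **`T_M(A) ≤ exp(Σ_{1 ≤ a < A} V_M(a))`** for `A ≥ 1`, by induction on the span:
`T(A+1) = T(A) + U(A) ≤ T(A)(1 + V(A)) ≤ T(A) e^{V(A)}` — the finite form of
"`Σ_N h_N z^N ≤ Π_A (1 + Σ_m b_{m,A} z^m) ≤ exp(B_z - 1)`".
[cite: MadrasSlade1993, §3.1, proof of Corollary 3.1.8] -/
theorem triT_le_exp (M : ℕ) {z : ℝ} (hz : 0 ≤ z) (k : ℕ) :
    triHsLTGF M z (k + 1 : ℕ) ≤ Real.exp (∑ a ∈ Finset.range k, triBrGF M z (a + 1 : ℕ)) := by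
  induction k with
  | zero =>
    simp only [Nat.zero_add, Nat.cast_one, Finset.range_zero, Finset.sum_empty, Real.exp_zero]
    exact triHsLTGF_one_le M z
  | succ k ih =>
    have hT0 : 0 ≤ triHsLTGF M z (k + 1 : ℕ) :=
      Finset.sum_nonneg fun n _ => by positivity
    have hV0 : 0 ≤ triBrGF M z (k + 1 : ℕ) := Finset.sum_nonneg fun n _ => by positivity
    rw [Finset.sum_range_succ, Real.exp_add, show ((k + 1 + 1 : ℕ) : ℤ) = ((k + 1 : ℕ) : ℤ) + 1 by
      push_cast; ring, triHsLTGF_succ]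
    calc triHsLTGF M z (k + 1 : ℕ) + ∑ n ∈ Finset.range (M + 1), ((triHsSpan n (k + 1 : ℕ)).card : ℝ) * z ^ n
        ≤ triHsLTGF M z (k + 1 : ℕ) + triBrGF M z (k + 1 : ℕ) * triHsLTGF M z (k + 1 : ℕ) := by
          gcongr
          exact sum_triHsSpan_le M hz (by exact_mod_cast Nat.succ_pos k)
      _ = triHsLTGF M z (k + 1 : ℕ) * (1 + triBrGF M z (k + 1 : ℕ)) := by ring
      _ ≤ Real.exp (∑ a ∈ Finset.range k, triBrGF M z (a + 1 : ℕ)) *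
            Real.exp (triBrGF M z (k + 1 : ℕ)) := by
          gcongr
          linarith [Real.add_one_le_exp (triBrGF M z (k + 1 : ℕ))]

/-- `Σ_{1≤a≤A} V_M(a) ≤ B⁺_M(z)`: the bridges of span `1, …, A` are among all bridges of positive
length (a bridge of length `n ≥ 1` has span `≥ 1`; the `0`-step bridge has span `0`): "`Σ_A Σ_n b_{n,A} zⁿ
= B_z - 1`". [cite: MadrasSlade1993, §3.1, proof of Corollary 3.1.8] -/
theorem sum_triBrGF_le (M : ℕ) {z : ℝ} (hz : 0 ≤ z) (k : ℕ) :
    ∑ a ∈ Finset.range k, triBrGF M z (a + 1 : ℕ) ≤ triBridgeGFpos M z := by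
  classical
  simp only [triBrGF, triBridgeGFpos]
  rw [Finset.sum_comm]
  refine Finset.sum_le_sum fun n hn => ?_
  rw [← Finset.sum_mul]
  split_ifs with hn0
  · subst hn0
    have : ∀ a ∈ Finset.range k, ((triBrSpan 0 (a + 1 : ℕ)).card : ℝ) = 0 := by
      intro a _
      rw [Nat.cast_eq_zero, Finset.card_eq_zero, triBrSpan, Finset.filter_eq_empty_iff]
      intro ω hω h
      obtain ⟨h00, -, -, -⟩ := mem_brickSaws.1 (mem_brickBridges.1 hω).1
      rw [h00] at h
      simp at h
      omega
    rw [Finset.sum_congr rfl this, Finset.sum_const_zero, zero_mul]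
  · refine mul_le_mul_of_nonneg_right ?_ (pow_nonneg hz n)
    -- distinct spans give disjoint subsets of `brickBridges n`
    have h1 : ∑ a ∈ Finset.range k, ((triBrSpan n (a + 1 : ℕ)).card : ℝ) =
        (((Finset.range k).biUnion fun a => triBrSpan n (a + 1 : ℕ)).card : ℝ) := by
      rw [Finset.card_biUnion]
      · push_cast; rfl
      · intro a _ b _ hab
        exact Finset.disjoint_filter.2 fun ω _ h1 h2 => hab (by push_cast at h1 h2; omega)
    rw [h1]
    exact_mod_cast Finset.card_le_card (Finset.biUnion_subset.2 fun a _ => Finset.filter_subset _ _)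

/-- **`Σ_{n≤M} h_n zⁿ ≤ exp(Σ_{1≤n≤M} b_n zⁿ)`** (`z ≥ 0`) — the finite form of Madras–Slade's
"`Σ_N h_N z^N ≤ exp(B_z - 1)`". [cite: MadrasSlade1993, §3.1, proof of Corollary 3.1.8] -/
theorem sum_brickHalfSpaceCount_le_exp (M : ℕ) {z : ℝ} (hz : 0 ≤ z) :
    ∑ n ∈ Finset.range (M + 1), (brickHalfSpaceCount n : ℝ) * z ^ n ≤ Real.exp (triBridgeGFpos M z) := by
  classical
  -- every walk of length `n ≤ M` has span `≤ n < M + 1`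
  have hT : ∑ n ∈ Finset.range (M + 1), (brickHalfSpaceCount n : ℝ) * z ^ n =
      triHsLTGF M z (2 * M + 1 : ℕ) := by
    refine Finset.sum_congr rfl fun n hn => ?_
    rw [Finset.mem_range] at hn
    congr 2
    rw [brickHalfSpaceCount, triHsSpanLT, Finset.filter_true_of_mem]
    intro ω hω
    obtain ⟨h00, -, hadj, -⟩ := mem_brickSaws.1 (mem_brickHalfSpaceWalks.1 hω).1
    have hml : Zd.maxLevel n ω ≤ 2 * (n : ℤ) := Zd.maxLevel_le fun i hi =>
      (apply_zero_le_two_mul_of_brick h00 hadj i hi).trans (by omega)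
    have hnM : 2 * (n : ℤ) < ((2 * M + 1 : ℕ) : ℤ) := by push_cast; omega
    exact lt_of_le_of_lt hml hnM
  rw [hT]
  exact (triT_le_exp M hz (2 * M)).trans (Real.exp_le_exp.2 (sum_triBrGF_le M hz (2 * M)))

/-- **Madras–Slade (3.1.13), finite form** (= Hutchcroft 2018 Prop. 2.1 "`χ(z) ≤ z^{-1} exp[2B(z)-2]`"):
`Σ_{n≤M} c_n z^{n+1} ≤ exp(2 Σ_{1≤n≤M+1} b_n zⁿ)` for `z ≥ 0`.
[cite: MadrasSlade1993, §3.1, eq. (3.1.13); Hutchcroft2018HammersleyWelsh, Proposition 2.1] -/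
theorem sum_triSawCount_le_exp (M : ℕ) {z : ℝ} (hz : 0 ≤ z) :
    ∑ n ∈ Finset.range (M + 1), (triSawCount n : ℝ) * z ^ (n + 1) ≤
      Real.exp (2 * triBridgeGFpos (M + 1) z) := by
  set H : ℝ := ∑ n ∈ Finset.range (M + 2), (brickHalfSpaceCount n : ℝ) * z ^ n with hH
  have hH0 : ∀ n, (0 : ℝ) ≤ (brickHalfSpaceCount n : ℝ) * z ^ n := fun n => by positivity
  have hHexp : H ≤ Real.exp (triBridgeGFpos (M + 1) z) := sum_brickHalfSpaceCount_le_exp (M + 1) hz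
  have hHnn : 0 ≤ H := Finset.sum_nonneg fun n _ => hH0 n
  -- `c_n z^{n+1} ≤ Σ_m (h_{m+1} z^{m+1}) (h_{n-m} z^{n-m})`
  have h1 : ∑ n ∈ Finset.range (M + 1), (triSawCount n : ℝ) * z ^ (n + 1) ≤
      ∑ n ∈ Finset.range (M + 1), ∑ m ∈ Finset.range (n + 1),
        ((brickHalfSpaceCount (m + 1) : ℝ) * z ^ (m + 1)) * ((brickHalfSpaceCount (n - m) : ℝ) * z ^ (n - m)) := by
    refine Finset.sum_le_sum fun n hn => ?_
    have hc : (triSawCount n : ℝ) ≤ ∑ m ∈ Finset.range (n + 1),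
        (brickHalfSpaceCount (m + 1) : ℝ) * brickHalfSpaceCount (n - m) := by
      exact_mod_cast triSawCount_le_sum_brickHalfSpaceCount n
    calc (triSawCount n : ℝ) * z ^ (n + 1)
        ≤ (∑ m ∈ Finset.range (n + 1), (brickHalfSpaceCount (m + 1) : ℝ) * brickHalfSpaceCount (n - m)) *
            z ^ (n + 1) := mul_le_mul_of_nonneg_right hc (pow_nonneg hz _)
      _ = _ := by
          rw [Finset.sum_mul]
          refine Finset.sum_congr rfl fun m hm => ?_
          rw [Finset.mem_range] at hm
          rw [show z ^ (n + 1) = z ^ (m + 1) * z ^ (n - m) by rw [← pow_add]; congr 1; omega]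
          ring
  -- `≤ (Σ_{m≤M} h_{m+1} z^{m+1}) (Σ_{k≤M} h_k z^k) ≤ H · H`
  have h2 := Zd.sum_range_triangle_le (f := fun m => (brickHalfSpaceCount (m + 1) : ℝ) * z ^ (m + 1))
    (g := fun k => (brickHalfSpaceCount k : ℝ) * z ^ k) (fun i => hH0 (i + 1)) (fun i => hH0 i) M
  have h3 : ∑ m ∈ Finset.range (M + 1), (brickHalfSpaceCount (m + 1) : ℝ) * z ^ (m + 1) ≤ H := by
    rw [hH, Finset.sum_range_succ' _ (M + 1)]
    linarith [hH0 0]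
  have h4 : ∑ k ∈ Finset.range (M + 1), (brickHalfSpaceCount k : ℝ) * z ^ k ≤ H := by
    rw [hH, Finset.sum_range_succ _ (M + 1)]
    linarith [hH0 (M + 1)]
  calc ∑ n ∈ Finset.range (M + 1), (triSawCount n : ℝ) * z ^ (n + 1)
      ≤ _ := h1
    _ ≤ _ := h2
    _ ≤ H * H := mul_le_mul h3 h4 (Finset.sum_nonneg fun k _ => hH0 k) hHnn
    _ ≤ Real.exp (triBridgeGFpos (M + 1) z) * Real.exp (triBridgeGFpos (M + 1) z) :=
        mul_le_mul hHexp hHexp hHnn (Real.exp_nonneg _)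
    _ = Real.exp (2 * triBridgeGFpos (M + 1) z) := by rw [← Real.exp_add]; ring_nf

/-- **Madras–Slade (3.1.14) at `z = z_c`, finite form: `Σ_{n=1}^{M+1} b_n μ^{-n} ≥ ½ log((M+1)/μ)`**
(from (3.1.13) and `μⁿ ≤ cₙ`, i.e. `c_n z_c^n ≥ 1`). [cite: MadrasSlade1993, §3.1, eq. (3.1.14)] -/
theorem half_log_le_sum_brickBridgeCount (M : ℕ) :
    Real.log ((M + 1 : ℝ) / Real.exp logMuTri) / 2 ≤
      triBridgeGFpos (M + 1) (Real.exp logMuTri)⁻¹ := by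
  have hμ := Real.exp_pos logMuTri
  set z : ℝ := (Real.exp logMuTri)⁻¹ with hz
  have hz0 : 0 < z := inv_pos.2 hμ
  -- `(M+1) z ≤ Σ_{n≤M} c_n z^{n+1}`
  have h1 : ((M : ℝ) + 1) * z ≤ ∑ n ∈ Finset.range (M + 1), (triSawCount n : ℝ) * z ^ (n + 1) := by
    have : ∀ n ∈ Finset.range (M + 1), z ≤ (triSawCount n : ℝ) * z ^ (n + 1) := by
      intro n _
      have hc := exp_logMuTri_pow_le_triSawCount n
      have hzn : z ^ n * Real.exp logMuTri ^ n = 1 := by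
        rw [hz, ← mul_pow, inv_mul_cancel₀ hμ.ne', one_pow]
      calc z = z * (z ^ n * Real.exp logMuTri ^ n) := by rw [hzn, mul_one]
        _ ≤ z * (z ^ n * triSawCount n) := by gcongr
        _ = (triSawCount n : ℝ) * z ^ (n + 1) := by ring
    calc ((M : ℝ) + 1) * z = ∑ _n ∈ Finset.range (M + 1), z := by
          rw [Finset.sum_const, Finset.card_range, nsmul_eq_mul]; push_cast; ring
      _ ≤ _ := Finset.sum_le_sum this
  have h2 := sum_triSawCount_le_exp M hz0.le
  have h3 : ((M : ℝ) + 1) * z ≤ Real.exp (2 * triBridgeGFpos (M + 1) z) := h1.trans h2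
  have h4 : Real.log (((M : ℝ) + 1) * z) ≤ 2 * triBridgeGFpos (M + 1) z := by
    rw [← Real.log_exp (2 * triBridgeGFpos (M + 1) z)]
    exact Real.log_le_log (by positivity) h3
  rw [div_eq_mul_inv ((M : ℝ) + 1), ← hz]
  linarith

/-- **Madras–Slade Corollary 3.1.8 on the triangular lattice** (Kesten 1963): the bridge generating function
diverges at the critical point, `Σ_n b_n(𝕋) μ(𝕋)^{−n} = +∞` — the partial sums exceed `½ log((M+1)/μ(𝕋)) → ∞`.
[cite: MadrasSlade1993, Corollary 3.1.8, eq. (3.1.11) (p. 61)] [cite: Kesten1963SAW, §4] -/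
theorem not_summable_brickBridgeCount_div_pow :
    ¬ Summable fun N : ℕ => (brickBridgeCount N : ℝ) / Real.exp logMuTri ^ N := by
  intro hsum
  have hμ := Real.exp_pos logMuTri
  set S : ℝ := ∑' N : ℕ, (brickBridgeCount N : ℝ) / Real.exp logMuTri ^ N with hS
  have hnn : ∀ N, 0 ≤ (brickBridgeCount N : ℝ) / Real.exp logMuTri ^ N := fun N => by positivity
  have hle : ∀ M, triBridgeGFpos (M + 1) (Real.exp logMuTri)⁻¹ ≤ S := by
    intro M
    calc triBridgeGFpos (M + 1) (Real.exp logMuTri)⁻¹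
        ≤ ∑ N ∈ Finset.range (M + 2), (brickBridgeCount N : ℝ) / Real.exp logMuTri ^ N := by
          refine Finset.sum_le_sum fun N _ => ?_
          split_ifs
          · exact hnn N
          · rw [div_eq_mul_inv, inv_pow]
      _ ≤ S := hsum.sum_le_tsum _ (fun N _ => hnn N)
  obtain ⟨M, hM⟩ : ∃ M : ℕ, Real.exp (2 * S) * Real.exp logMuTri < (M : ℝ) + 1 :=
    ⟨Nat.ceil (Real.exp (2 * S) * Real.exp logMuTri), (Nat.le_ceil _).trans_lt (by linarith)⟩
  have h1 := (half_log_le_sum_brickBridgeCount M).trans (hle M)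
  have h2 : Real.log (((M : ℝ) + 1) / Real.exp logMuTri) ≤ 2 * S := by linarith
  have h3 : ((M : ℝ) + 1) / Real.exp logMuTri ≤ Real.exp (2 * S) := by
    rw [← Real.exp_log (show 0 < ((M : ℝ) + 1) / Real.exp logMuTri by positivity)]
    exact Real.exp_le_exp.2 h2
  rw [div_le_iff₀ hμ] at h3
  linarith

/-- **Kesten's relation on the triangular lattice**: `Σ_k λ_k(𝕋) μ(𝕋)^{−k} = 1` — the irreducible-bridge
weights at the critical fugacity form a probability distribution (M–S (4.2.4) on `𝕋`; asserted for `𝕋` in the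
enumeration literature, first written proof here). [cite: MadrasSlade1993, §4.2, eq. (4.2.4) (p. 91)]
[cite: Kesten1963SAW, §4 (Thm 5)] [cite: Jensen2004SAWLowerBounds, §2 ("1/μ is the solution to A(x) = 1"; triangular lattice)]
[cite: Alm2005, §5.5.1] -/
theorem hasSum_brickIrreducibleBridgeCount_div_pow :
    HasSum (fun k => (brickIrreducibleBridgeCount k : ℝ) / Real.exp logMuTri ^ k) 1 :=
  hasSum_brickIrreducibleBridgeCount_div_pow_of_not_summable not_summable_brickBridgeCount_div_pow

/-- `Σ' k, λ_k(𝕋) μ(𝕋)^{−k} = 1`. [cite: MadrasSlade1993, §4.2, eq. (4.2.4) (p. 91)] [cite: Jensen2004SAWLowerBounds, §2] -/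
theorem tsum_brickIrreducibleBridgeCount_div_pow :
    ∑' k, (brickIrreducibleBridgeCount k : ℝ) / Real.exp logMuTri ^ k = 1 :=
  hasSum_brickIrreducibleBridgeCount_div_pow.tsum_eq


/-! ### The renewal theorem: `lim_N b_N(𝕋) μ(𝕋)^{−N}` exists -/

/-- `λ_1(𝕋) = b_1(𝕋)`: a one-step bridge has no interior renewal time (text: a-idea-1 gen 14).
[cite: MadrasSlade1993, Definition 4.2.1 (p. 89)] -/
theorem brickIrreducibleBridgeCount_one : brickIrreducibleBridgeCount 1 = brickBridgeCount 1 := by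
  classical
  unfold brickIrreducibleBridgeCount brickIrreducibleBridges brickBridgeCount
  congr 1
  apply Finset.filter_true_of_mem
  intro ω hω
  refine ⟨le_rfl, (mem_brickBridges.1 hω).2, ?_⟩
  intro k hk1 hk2
  omega

/-- `λ_1(𝕋) μ(𝕋)^{−1} > 0` (aperiodicity of the renewal sequence). [cite: MadrasSlade1993, §4.2, Theorem 4.2.2 (p. 91)] -/
theorem brickIrreducibleBridgeCount_div_pow_one_pos :
    0 < (brickIrreducibleBridgeCount 1 : ℝ) / Real.exp logMuTri ^ 1 := by
  have h : (1 : ℝ) ≤ brickIrreducibleBridgeCount 1 := by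
    rw [brickIrreducibleBridgeCount_one]; exact_mod_cast one_le_brickBridgeCount 1
  positivity

/-- **`lim_{N→∞} b_N(𝕋)/μ(𝕋)^N` exists** (and equals `(Σ_k k λ_k μ^{−k})^{−1}`, read as `0` when the mean is
infinite): the Erdős–Feller–Pollard renewal theorem applied to `a_N = b_N μ^{−N}`, `p_k = λ_k μ^{−k}` (Kesten's
relation makes `p` a probability distribution; `p_1 > 0` gives aperiodicity). Printed for `ℤ^d` (M–S p. 91:
"the Renewal Theorem implies that `lim b_N/μ^N` exists and equals `(Σ k p_k)^{−1}`"); whether it is `0` is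
open (M–S p. 92) and is not decided here. Glue text: a-idea-1 gen 14 (face «TRI-BRIDGE-LIMIT»).
[cite: MadrasSlade1993, §4.2, Theorem 4.2.2 and p. 91–92] [cite: Kesten1963SAW, §4] -/
theorem exists_tendsto_brickBridgeCount_div_pow :
    ∃ L : ℝ, Tendsto (fun N : ℕ => (brickBridgeCount N : ℝ) / Real.exp logMuTri ^ N) atTop (𝓝 L) := by
  have hu0 := brickBridgeCount_div_pow_zero
  have hf0 : (brickIrreducibleBridgeCount 0 : ℝ) / Real.exp logMuTri ^ 0 = 0 := by
    simp [brickIrreducibleBridgeCount_zero]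
  by_cases hmean : Summable fun k : ℕ => (k : ℝ) * ((brickIrreducibleBridgeCount k : ℝ) / Real.exp logMuTri ^ k)
  · exact ⟨_, Literature.Probability.Process.Renewal.tendsto_of_summable_mul
      (u := fun n => (brickBridgeCount n : ℝ) / Real.exp logMuTri ^ n)
      (f := fun k => (brickIrreducibleBridgeCount k : ℝ) / Real.exp logMuTri ^ k)
      hu0 (fun n => by positivity) brickBridgeCount_div_pow_le_one (fun k => by positivity) hf0
      (fun n hn => brickBridgeCount_div_pow_eq_sum hn) hasSum_brickIrreducibleBridgeCount_div_pow
      brickIrreducibleBridgeCount_div_pow_one_pos hmean⟩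
  · exact ⟨0, Literature.Probability.Process.Renewal.tendsto_zero_of_not_summable_mul
      (u := fun n => (brickBridgeCount n : ℝ) / Real.exp logMuTri ^ n)
      (f := fun k => (brickIrreducibleBridgeCount k : ℝ) / Real.exp logMuTri ^ k)
      hu0 (fun n => by positivity) brickBridgeCount_div_pow_le_one (fun k => by positivity) hf0
      (fun n hn => brickBridgeCount_div_pow_eq_sum hn) hasSum_brickIrreducibleBridgeCount_div_pow
      brickIrreducibleBridgeCount_div_pow_one_pos hmean⟩

end Literature.Probability.RandomPlanarGeometry.SAW

end
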